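import Mathlib
import HarnessLib
import Summits.Ventures.LatticeQCDFlow.Exactness.NCMCGeneralSpaceRestartChainCLT
import Summits.Ventures.LatticeQCDFlow.Exactness.NCMCGeneralSpaceRestartChainVarianceDichotomy
import Summits.Ventures.LatticeQCDFlow.Exactness.NCMCGeneralSpaceReplicaTStatisticIndep
import Summits.Ventures.LatticeQCDFlow.Exactness.NCMCGeneralSpaceReplicaJackknifeDeltaMethod

/-!
# `free_energy`'s POOLED `dF ± q·dF_err` over `R ≥ 2` independent streams of correlated launches has limiting coverage `L_R(q)` (the delete-one-stream jackknife of `−log` of the pooled mean weight)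

HONEST FRAMING: exact (Metropolis-corrected) sampling algorithms for lattice gauge theory;
figures of merit are autocorrelation/cost numbers at stated couplings and volumes; no
continuum-physics claim.

Venture `LatticeQCDFlow` (cell pub-lqcd), topic `Exactness`; FANOUT row 13 (`eng-snf`, GEN-25).
NEW WORK of the cell: the engine-side instance of GEN-25's
`NCMCGeneralSpaceReplicaJackknifeDeltaMethod` (pooled nonlinear jackknife ⇒ `L_R(q)`) along GEN-22's
restart chain (`CrooksPair.tendstoInDistribution_sampleMean_exp_neg_work_restartChain`, the CLT for
the mean weight from every initial record law; GEN-23 V: the variance is positive iff the work is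
not a.s. exact) and GEN-23's `tendstoInDistribution_pi_toLp` (independent streams ⇒ the replica
VECTOR converges).  Not a published result; no definition; nothing cited as a fact.

WHY (row 13).  GEN-24 J (`…ReplicaJarzynskiJackknife`) typed the bar of the MEAN OF PER-STREAM
ESTIMATES `(1/R) Σ_r ΔF̂_r`.  The engine does not print that: `estimators.free_energy` run on the
concatenated records of `R` streams with `block_ids` = stream labels prints `dF = −log Ȳ`, `Ȳ` the
mean weight over ALL records `= (1/R) Σ_r Ȳ_r` (equal stream lengths), and the delete-one-STREAM
jackknife `dF_err` of that pooled statistic (replicates `−log((Σ_{s≠r} Ȳ_s)/(R−1))`, centred at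
their mean; `dF_biascorr = R·dF − (R−1)·mean`).  THIS file: for a Crooks pair with `Z₀ ≠ 0`,
`e^{−ΔF} = Z₁/Z₀`, work bounded below and not `P_F`-a.s. exact, a `ν₀`-invariant Markov level
sampler `K` dominating a non-zero measure from every configuration, and `R ≥ 2` INDEPENDENT streams
of correlated launches with ANY initial record laws: for every bias-correction weight `κ` and every
`q ≥ 0`, `P(|dF + κ(dF − mean) − ΔF| ≤ q·dF_err) → L_R(q) = N(0,1)^{⊗R}{|t| ≤ q}` (as the
studentised ratio) — the same universal Student-type limit as J's bar (value: GEN-24 S/B/T/F7).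

* **`CrooksPair.tendsto_measure_abs_pooledJarzynskiJackknife_le_restartChains`** — the statement
  above (hypothesis `0 < ∫ (e^{−W} − Z₁/Z₀)² dP_F`);
* **`…_everyStart`** — stream `r` launched from ANY configuration `x_r` (`μ_r = κF(x_r, ·)`).

NOT CLAIMED: unbounded work; streams of unequal lengths; dependent streams (branched off one run —
combine GEN-24 D3 with the same theorem once built); contiguous blocks of ONE stream; anything
numerical.
-/

namespace Summit.Ventures.LatticeQCDFlow.Exactness.GeneralNCMC

open MeasureTheory ProbabilityTheory Set Filter Finset WithLp
open scoped ENNReal NNReal Topology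

variable {Ω E : Type*} [MeasurableSpace Ω] [MeasurableSpace E]

namespace CrooksPair

variable {ν₀ ν₁ : Measure Ω} [IsFiniteMeasure ν₀] [IsFiniteMeasure ν₁] {κF κR : Kernel Ω E}
  [IsMarkovKernel κF] [IsMarkovKernel κR] {s e : E → Ω} {W : E → ℝ}
  {ι : Type*} [Fintype ι] [DecidableEq ι] [Nontrivial ι]

omit [IsFiniteMeasure ν₁] in
/-- **THE ENGINE'S POOLED `dF (+ κ·(dF − mean)) ± q·dF_err` OVER `R ≥ 2` INDEPENDENT STREAMS OF
CORRELATED LAUNCHES HAS LIMITING COVERAGE `L_R(q)`.**  Crooks pair, `Z₀ ≠ 0`, `e^{−ΔF} = Z₁/Z₀`,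
`−B ≤ W`, `0 < ∫ (e^{−W} − Z₁/Z₀)² dP_F`; `K` Markov, `ν₀`-invariant, `m ≤ K(z, ·)` for all `z`
(`m` finite, non-zero); stream `r` has initial record law `μ_r`, the streams are independent
(law `⊗_r P_{μ_r}`); `Ȳ_{r,n}` = mean weight of the first `n` records of stream `r`; `κ` real,
`q ≥ 0`. -/
theorem tendsto_measure_abs_pooledJarzynskiJackknife_le_restartChains (K : Kernel Ω Ω)
    [IsMarkovKernel K] (h0 : ν₀ univ ≠ 0) (hK : Kernel.Invariant K ν₀)
    (h : CrooksPair ν₀ ν₁ κF κR s e W) {ΔF : ℝ}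
    (hΔF : Real.exp (-ΔF) = ((ν₀ univ)⁻¹ * ν₁ univ).toReal) {m : Measure Ω} [IsFiniteMeasure m]
    (hm0 : m univ ≠ 0) (hmin : ∀ z, m ≤ K z) {B : ℝ} (hB : ∀ ω, -B ≤ W ω)
    (hV : 0 < ∫ ω, (Real.exp (-W ω) - ((ν₀ univ)⁻¹ * ν₁ univ).toReal) ^ 2 ∂(fwdPathLaw ν₀ κF))
    (μ : ι → Measure E) [∀ r, IsProbabilityMeasure (μ r)]
    [∀ r, IsProbabilityMeasure (Kernel.trajMeasure (X := fun _ : ℕ => E) (μ r)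
        (fun n : ℕ => ((κF ∘ₖ K).comap s h.measurable_s).comap
          (fun hh : (j : ↥(Finset.Iic n)) → E => hh ⟨n, Finset.mem_Iic.2 le_rfl⟩)
          (measurable_pi_apply _)))] (κ : ℝ) {q : ℝ} (hq : 0 ≤ q) :
    Tendsto (fun n : ℕ => (Measure.pi fun r => Kernel.trajMeasure (X := fun _ : ℕ => E) (μ r)
        (fun n : ℕ => ((κF ∘ₖ K).comap s h.measurable_s).comap
          (fun hh : (j : ↥(Finset.Iic n)) → E => hh ⟨n, Finset.mem_Iic.2 le_rfl⟩)
          (measurable_pi_apply _)))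
        {ω : ι → ℕ → E |
          |(-Real.log ((∑ r, sampleMean (fun ε => Real.exp (-W ε)) (fun i : Fin n => ω r i))
                / Fintype.card ι)
              + κ * (-Real.log ((∑ r, sampleMean (fun ε => Real.exp (-W ε))
                  (fun i : Fin n => ω r i)) / Fintype.card ι)
                - (∑ t, -Real.log ((∑ r ∈ univ.erase t, sampleMean (fun ε => Real.exp (-W ε))
                    (fun i : Fin n => ω r i)) / ((Fintype.card ι : ℝ) - 1))) / Fintype.card ι)
              - ΔF)
            / Real.sqrt (((Fintype.card ι : ℝ) - 1) / Fintype.card ι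
              * ∑ r, (-Real.log ((∑ u ∈ univ.erase r, sampleMean (fun ε => Real.exp (-W ε))
                    (fun i : Fin n => ω u i)) / ((Fintype.card ι : ℝ) - 1))
                - (∑ t, -Real.log ((∑ u ∈ univ.erase t, sampleMean (fun ε => Real.exp (-W ε))
                    (fun i : Fin n => ω u i)) / ((Fintype.card ι : ℝ) - 1))) / Fintype.card ι) ^ 2)|
            ≤ q})
      atTop
      (𝓝 ((Measure.pi fun _ : ι => gaussianReal 0 1) {z : ι → ℝ | |(∑ r, z r) / Fintype.card ι
        / Real.sqrt ((∑ r, (z r - (∑ r', z r') / Fintype.card ι) ^ 2)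
            / ((Fintype.card ι : ℝ) * (Fintype.card ι - 1)))| ≤ q})) := by
  set θ : ℝ := ((ν₀ univ)⁻¹ * ν₁ univ).toReal with hθdef
  have hθ : 0 < θ := by rw [← hΔF]; exact Real.exp_pos _
  have hlogθ : -Real.log θ = ΔF := by rw [← hΔF, Real.log_exp, neg_neg]
  set σ2 : ℝ := (∫ ω, (Real.exp (-W ω) - θ) ^ 2 ∂(fwdPathLaw ν₀ κF))
      + 2 * ∑' k, ∫ ω, (Real.exp (-W ω) - θ)
        * (Scoring.kop ((κF ∘ₖ K).comap s h.measurable_s))^[k + 1]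
            (fun ω => Real.exp (-W ω) - θ) ω ∂(fwdPathLaw ν₀ κF) with hσ2
  -- the checkable variance hypothesis gives a positive Green–Kubo variance
  have hσ2pos : 0 < σ2 := by
    have heq : σ2 = Scoring.autocov ((κF ∘ₖ K).comap s h.measurable_s) (fwdPathLaw ν₀ κF)
          (fun ω => Real.exp (-W ω) - θ) 0
        + 2 * ∑' t, Scoring.autocov ((κF ∘ₖ K).comap s h.measurable_s) (fwdPathLaw ν₀ κF)
          (fun ω => Real.exp (-W ω) - θ) (t + 1) := by
      rw [hσ2]
      unfold Scoring.autocov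
      simp only [Function.iterate_zero, id_eq, sq]
    rw [heq]
    exact (h.greenKubo_variance_exp_neg_work_restartChain_pos_iff K h0 hK hm0 hmin hB).2 hV
  have hv : σ2.toNNReal ≠ 0 := by
    rw [Ne, Real.toNNReal_eq_zero, not_le]
    exact hσ2pos
  -- per-stream CLT for the mean weight, against the identity on `(ℝ, N(0, σ²_w))`
  have hclt : ∀ r : ι, TendstoInDistribution (fun (n : ℕ) (ω : ℕ → E) =>
        Real.sqrt (n : ℝ)
          * (sampleMean (fun ε => Real.exp (-W ε)) (fun i : Fin n => ω i) - θ))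
      atTop id (fun _ => Kernel.trajMeasure (X := fun _ : ℕ => E) (μ r)
        (fun n : ℕ => ((κF ∘ₖ K).comap s h.measurable_s).comap
          (fun hh : (j : ↥(Finset.Iic n)) → E => hh ⟨n, Finset.mem_Iic.2 le_rfl⟩)
          (measurable_pi_apply _))) (gaussianReal 0 σ2.toNNReal) := fun r =>
    h.tendstoInDistribution_sampleMean_exp_neg_work_restartChain K h0 hK hm0 hmin hB (μ r)
      (P' := gaussianReal 0 σ2.toNNReal) (Y := id) HasLaw.id
  -- independent streams: the replica VECTOR converges to the product Gaussian
  have hvec := tendstoInDistribution_pi_toLp (Ω := fun _ : ι => ℕ → E)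
    (X := fun (_ : ι) (n : ℕ) (ω : ℕ → E) =>
      Real.sqrt (n : ℝ) * (sampleMean (fun ε => Real.exp (-W ε)) (fun i : Fin n => ω i) - θ))
    (fun _ n => measurable_const.mul ((measurable_sampleMean_run
      (Real.measurable_exp.comp h.measurable_W.neg) n).sub measurable_const)) hclt
  -- the pooled nonlinear jackknife theorem with `φ = −log`, `a = Z₁/Z₀`, `c = −(Z₁/Z₀)⁻¹ ≠ 0`
  have hmain := tendsto_measure_abs_pooledJackknife_le
    (P := Measure.pi fun r => Kernel.trajMeasure (X := fun _ : ℕ => E) (μ r)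
        (fun n : ℕ => ((κF ∘ₖ K).comap s h.measurable_s).comap
          (fun hh : (j : ↥(Finset.Iic n)) → E => hh ⟨n, Finset.mem_Iic.2 le_rfl⟩)
          (measurable_pi_apply _)))
    (A := fun (n : ℕ) (ω : ι → ℕ → E) (r : ι) =>
      sampleMean (fun ε => Real.exp (-W ε)) (fun i : Fin n => ω r i))
    (fun n => measurable_pi_lambda _ fun r => (measurable_sampleMean_run
      (Real.measurable_exp.comp h.measurable_W.neg) n).comp (measurable_pi_apply r))
    (φ := fun x => -Real.log x) Real.measurable_log.neg
    ((Real.hasDerivAt_log hθ.ne').neg) (neg_ne_zero.2 (inv_ne_zero hθ.ne')) hv hvec κ hq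
  rw [hlogθ] at hmain
  exact hmain

omit [IsFiniteMeasure ν₁] in
/-- **The engine's form**: stream `r` launched from ANY configuration `x_r` (`μ_r = κF(x_r, ·)`); in
particular `κ = 0` is `dF ± q·dF_err` and `κ = R − 1` is `dF_biascorr ± q·dF_err`. -/
theorem tendsto_measure_abs_pooledJarzynskiJackknife_le_restartChains_everyStart (K : Kernel Ω Ω)
    [IsMarkovKernel K] (h0 : ν₀ univ ≠ 0) (hK : Kernel.Invariant K ν₀)
    (h : CrooksPair ν₀ ν₁ κF κR s e W) {ΔF : ℝ}
    (hΔF : Real.exp (-ΔF) = ((ν₀ univ)⁻¹ * ν₁ univ).toReal) {m : Measure Ω} [IsFiniteMeasure m]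
    (hm0 : m univ ≠ 0) (hmin : ∀ z, m ≤ K z) {B : ℝ} (hB : ∀ ω, -B ≤ W ω)
    (hV : 0 < ∫ ω, (Real.exp (-W ω) - ((ν₀ univ)⁻¹ * ν₁ univ).toReal) ^ 2 ∂(fwdPathLaw ν₀ κF))
    (x : ι → Ω)
    [∀ r, IsProbabilityMeasure (Kernel.trajMeasure (X := fun _ : ℕ => E) (κF (x r))
        (fun n : ℕ => ((κF ∘ₖ K).comap s h.measurable_s).comap
          (fun hh : (j : ↥(Finset.Iic n)) → E => hh ⟨n, Finset.mem_Iic.2 le_rfl⟩)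
          (measurable_pi_apply _)))] (κ : ℝ) {q : ℝ} (hq : 0 ≤ q) :
    Tendsto (fun n : ℕ => (Measure.pi fun r => Kernel.trajMeasure (X := fun _ : ℕ => E) (κF (x r))
        (fun n : ℕ => ((κF ∘ₖ K).comap s h.measurable_s).comap
          (fun hh : (j : ↥(Finset.Iic n)) → E => hh ⟨n, Finset.mem_Iic.2 le_rfl⟩)
          (measurable_pi_apply _)))
        {ω : ι → ℕ → E |
          |(-Real.log ((∑ r, sampleMean (fun ε => Real.exp (-W ε)) (fun i : Fin n => ω r i))
                / Fintype.card ι)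
              + κ * (-Real.log ((∑ r, sampleMean (fun ε => Real.exp (-W ε))
                  (fun i : Fin n => ω r i)) / Fintype.card ι)
                - (∑ t, -Real.log ((∑ r ∈ univ.erase t, sampleMean (fun ε => Real.exp (-W ε))
                    (fun i : Fin n => ω r i)) / ((Fintype.card ι : ℝ) - 1))) / Fintype.card ι)
              - ΔF)
            / Real.sqrt (((Fintype.card ι : ℝ) - 1) / Fintype.card ι
              * ∑ r, (-Real.log ((∑ u ∈ univ.erase r, sampleMean (fun ε => Real.exp (-W ε))
                    (fun i : Fin n => ω u i)) / ((Fintype.card ι : ℝ) - 1))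
                - (∑ t, -Real.log ((∑ u ∈ univ.erase t, sampleMean (fun ε => Real.exp (-W ε))
                    (fun i : Fin n => ω u i)) / ((Fintype.card ι : ℝ) - 1))) / Fintype.card ι) ^ 2)|
            ≤ q})
      atTop
      (𝓝 ((Measure.pi fun _ : ι => gaussianReal 0 1) {z : ι → ℝ | |(∑ r, z r) / Fintype.card ι
        / Real.sqrt ((∑ r, (z r - (∑ r', z r') / Fintype.card ι) ^ 2)
            / ((Fintype.card ι : ℝ) * (Fintype.card ι - 1)))| ≤ q})) :=
  h.tendsto_measure_abs_pooledJarzynskiJackknife_le_restartChains K h0 hK hΔF hm0 hmin hB hV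
    (fun r => κF (x r)) κ hq

end CrooksPair

end Summit.Ventures.LatticeQCDFlow.Exactness.GeneralNCMC
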